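import Literature.Topology.FourManifolds.ClosedModelCollapseTransfer
import Literature.Topology.FourManifolds.ClosedModelPuncturedCohomology
import Literature.Topology.FourManifolds.SignatureAdditivityCohomological
import Mathlib.Analysis.Convex.Contractible
import HarnessLib

/-!
# Additivity of the signature over a boundary connected sum: `σ(W_S ♮ W_T) = σ(W_S) + σ(W_T)`

M. Kervaire, J. Milnor, *Groups of homotopy spheres I*, Ann. of Math. 77 (1963), §2, p. 508:
"the connected sum along the boundary `W₁ ♮ W₂` … clearly has signature
`σ(W₁ ♮ W₂) = σ(W₁) + σ(W₂)`", the signatures being those of the closed homology manifolds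
`Ŵ = W ∪ cone(bW)` (§7, footnote pp. 528–529). This file assembles the proof from the tree's
pieces, over the ABSTRACT gluing data of `BCSOrientationGluing.lean` (two open pieces
`A_S ⊆ W_S`, `A_T ⊆ W_T` openly embedded in `W_U` — for a boundary connected sum the punctures are
BOUNDARY points, so each piece contains the whole interior) plus collars of the three manifolds
and two geometric facts about the gluing region:

* **(disc in collar)** a point of a piece which is glued to the other piece lies in the collar
  neighbourhood `κ(∂W × [0,1))` of its own manifold (the half-discs are chosen inside the
  collars);
* **(overlap contractible)** the interior overlap of the two pieces in `W_U` is contractible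
  (a punctured open half-ball).

From these: the collapse maps `π_S : Ŵ_U → Ŵ_S`, `π_T : Ŵ_U → Ŵ_T`
(`ClosedModelCollapseTransfer.lean`) carry `[Ŵ_U]` to `[Ŵ_S]`, `[Ŵ_T]` (given the local
identities furnished by the homological gluing `BCSGluing.exists_isRelFundamentalClass`); each
collapse sends the other piece into the contractible cone neighbourhood of the other cone point,
so the cross terms of the cup product pairing vanish and the restrictions to the two open copies
of the interiors detect `Hᵏ` (Mayer–Vietoris: `CohomologyMayerVietorisInjective/Extend`,
`ClosedModelPuncturedCohomology`); the cohomological mechanism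
`HomologicalOrientation.signatureInDim_eq_add_of_collapse` then gives additivity.

* `NullCobordism.Piece.interiorEmb` — the open embedding `int W_P → int W_U` of a piece
  containing the interior;
* `NullCobordism.BCSGluing.signatureInDim_eq_add` — the additivity theorem.

Everything is proved; no named facts.

## References

* M. A. Kervaire, J. W. Milnor, *Groups of homotopy spheres: I*, Ann. of Math. (2) 77 (1963),
  §2 p. 508, §7 footnote pp. 528–529. [KervaireMilnorAnnals1963]
* A. Hatcher, *Algebraic Topology*, CUP 2002, §3.1 pp. 203–204, §3.2 p. 209. [HatcherAT2002]
-/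

noncomputable section

open scoped Manifold ContDiff Topology
open Set Function CategoryTheory CategoryTheory.Limits Topology TopologicalSpace
open Literature.AlgebraicTopology.SingularHomology

namespace Literature.Topology.FourManifolds

namespace NullCobordism

variable {m : ℕ}
variable {MP : Type} [TopologicalSpace MP] [ChartedSpace (EuclideanSpace ℝ (Fin (m + 1))) MP]
  [IsManifold (𝓡 (m + 1)) ∞ MP] [CompactSpace MP]
variable {MU : Type} [TopologicalSpace MU] [ChartedSpace (EuclideanSpace ℝ (Fin (m + 1))) MU]
  [IsManifold (𝓡 (m + 1)) ∞ MU] [CompactSpace MU]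

/-! ### The interior embedding of a piece containing the interior -/

namespace Piece

variable {cP : NullCobordism (m + 1) MP} {cU : NullCobordism (m + 1) MU}

/-- A piece **contains the interior** (the puncture of a boundary connected sum is a boundary
point) — a parametrised predicate on pieces, not a named fact. [folklore] -/
def ContainsInterior (P : Piece cP cU) : Prop := ∀ x : cP.W, x ∈ (𝓡∂ (m + 1 + 1)).interior cP.W → x ∈ P.A

variable {P : Piece cP cU} (hP : P.ContainsInterior)

/-- The point of the piece under an interior point. [folklore] -/
abbrev ofInt (y : ManifoldInterior (m + 1) cP.W) : P.A := ⟨y.1, hP y.1 y.2⟩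

/-- **The interior embedding of the piece**: `int W_P → int W_U`, `y ↦ j y`. [folklore] -/
def interiorEmb : C(ManifoldInterior (m + 1) cP.W, ManifoldInterior (m + 1) cU.W) :=
  ⟨fun y => ⟨P.j (ofInt hP y), P.j_mem_interior y.2⟩,
    (P.j.continuous.comp (continuous_subtype_val.subtype_mk _)).subtype_mk _⟩

omit [IsManifold (𝓡 (m + 1)) ∞ MP] [CompactSpace MP] [IsManifold (𝓡 (m + 1)) ∞ MU]
  [CompactSpace MU] in
/-- Values of the interior embedding. [folklore] -/
@[simp] theorem interiorEmb_apply_val (y : ManifoldInterior (m + 1) cP.W) :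
    (interiorEmb hP y).1 = P.j (ofInt hP y) := rfl

omit [IsManifold (𝓡 (m + 1)) ∞ MP] [CompactSpace MP] [IsManifold (𝓡 (m + 1)) ∞ MU]
  [CompactSpace MU] in
/-- Values of the interior embedding. [folklore] -/
theorem interiorEmb_apply (y : ManifoldInterior (m + 1) cP.W) :
    interiorEmb hP y = ⟨P.j (ofInt hP y), P.j_mem_interior y.2⟩ := rfl

omit [IsManifold (𝓡 (m + 1)) ∞ MP] [CompactSpace MP] [IsManifold (𝓡 (m + 1)) ∞ MU]
  [CompactSpace MU] in
/-- The interior embedding is injective. [folklore] -/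
theorem interiorEmb_injective : Injective (interiorEmb hP) := fun a b h => by
  have h1 : P.j (ofInt hP a) = P.j (ofInt hP b) := congrArg (fun z : ManifoldInterior (m + 1) cU.W => z.1) h
  have h2 : (ofInt hP a : cP.W) = ofInt hP b := congrArg Subtype.val (P.j_injective h1)
  exact Subtype.ext h2

omit [CompactSpace MP] [IsManifold (𝓡 (m + 1)) ∞ MU] [CompactSpace MU] [IsManifold (𝓡 (m + 1)) ∞ MP] in
/-- **The interior embedding is an open embedding** (the inclusion of the open interior into the
piece, followed by `j`, corestricted to the open interior of `W_U`). [folklore] -/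
theorem isOpenEmbedding_interiorEmb : IsOpenEmbedding (interiorEmb hP) := by
  -- `val_U ∘ interiorEmb = j ∘ (interior ↪ A)`, an open embedding
  have hval : IsOpenEmbedding (fun z : ManifoldInterior (m + 1) cU.W => z.1) :=
    ((𝓡∂ (m + 1 + 1)).isOpen_interior (M := cU.W) one_ne_zero).isOpenEmbedding_subtypeVal
  have hincl : IsOpenEmbedding (fun y : ManifoldInterior (m + 1) cP.W => (ofInt hP y : P.A)) := by
    refine IsOpenEmbedding.of_comp _ P.isOpenEmbedding_ι ?_
    exact ((𝓡∂ (m + 1 + 1)).isOpen_interior (M := cP.W) one_ne_zero).isOpenEmbedding_subtypeVal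
  have hcomp : (fun z : ManifoldInterior (m + 1) cU.W => z.1) ∘ interiorEmb hP =
      P.j ∘ fun y : ManifoldInterior (m + 1) cP.W => (ofInt hP y : P.A) := rfl
  exact IsOpenEmbedding.of_comp _ hval (hcomp ▸ P.isOpenEmbedding_j.comp hincl)

omit [IsManifold (𝓡 (m + 1)) ∞ MP] [CompactSpace MP] [IsManifold (𝓡 (m + 1)) ∞ MU]
  [CompactSpace MU] in
/-- The image of the interior embedding is `j(int W_P)` read in `int W_U`. [folklore] -/
theorem mem_range_interiorEmb_iff (z : ManifoldInterior (m + 1) cU.W) :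
    z ∈ range (interiorEmb hP) ↔ z.1 ∈ range P.j := by
  constructor
  · rintro ⟨y, rfl⟩
    exact ⟨_, rfl⟩
  · rintro ⟨x, hx⟩
    have hxint : (x : cP.W) ∈ (𝓡∂ (m + 1 + 1)).interior cP.W := by
      rw [← ModelWithCorners.compl_boundary]
      intro hb
      have hz : (z.1 : cU.W) ∈ ((𝓡∂ (m + 1 + 1)).boundary cU.W)ᶜ := by
        rw [ModelWithCorners.compl_boundary]; exact z.2
      exact hz (hx ▸ (P.mem_boundary_iff x).1 hb)
    refine ⟨⟨x, hxint⟩, ?_⟩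
    apply Subtype.ext
    change P.j (ofInt hP ⟨x, hxint⟩) = z.1
    rw [← hx]

end Piece

/-! ### Collapse data of a glued null-cobordism -/

variable {MS : Type} [TopologicalSpace MS] [ChartedSpace (EuclideanSpace ℝ (Fin (m + 1))) MS]
  [IsManifold (𝓡 (m + 1)) ∞ MS] [CompactSpace MS]
variable {MT : Type} [TopologicalSpace MT] [ChartedSpace (EuclideanSpace ℝ (Fin (m + 1))) MT]
  [IsManifold (𝓡 (m + 1)) ∞ MT] [CompactSpace MT]
variable {cS : NullCobordism (m + 1) MS} {cT : NullCobordism (m + 1) MT} {cU : NullCobordism (m + 1) MU}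

namespace BCSGluing

variable (G : BCSGluing cS cT cU) (hS : G.S.ContainsInterior) (hT : G.T.ContainsInterior)

omit [IsManifold (𝓡 (m + 1)) ∞ MU] [CompactSpace MU] [IsManifold (𝓡 (m + 1)) ∞ MS] [CompactSpace MS]
  [IsManifold (𝓡 (m + 1)) ∞ MT] [CompactSpace MT] in
/-- The two interior embeddings cover the interior of `W_U`. [folklore] -/
theorem range_interiorEmb_union :
    range (Piece.interiorEmb hS) ∪ range (Piece.interiorEmb hT) = univ := by
  refine eq_univ_of_forall fun z => ?_
  have hz : z.1 ∈ range G.S.j ∪ range G.T.j := by rw [G.union_range]; exact mem_univ _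
  rcases hz with h | h
  · exact Or.inl ((Piece.mem_range_interiorEmb_iff hS z).2 h)
  · exact Or.inr ((Piece.mem_range_interiorEmb_iff hT z).2 h)

end BCSGluing

/-! ### Generalities: factorisation through an acyclic subspace, the punctured model -/

/-- If `f` maps `S ⊆ X` into `T ⊆ Y` and `Hᵏ(↥T) = 0`, then `(f ∘ incl_S)^* = 0` on `Hᵏ`
(it factors through `Hᵏ(↥T)`). [folklore] -/
theorem _root_.Literature.AlgebraicTopology.SingularHomology.singularCohomology.map_comp_subsetIncl_eq_zero_of_mapsTo
    {X Y : Type} [TopologicalSpace X] [TopologicalSpace Y] (f : C(X, Y)) {S : Set X} {T : Set Y}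
    (h : MapsTo f S T) {k : ℕ} (hZ : IsZero (singularCohomology ℤ ℤ (↥T) k)) :
    singularCohomology.map ℤ ℤ (f.comp (subsetIncl S)) k = 0 := by
  have hfac : f.comp (subsetIncl S) = (subsetIncl T).comp ⟨h.restrict f S T,
      (f.continuous.comp continuous_subtype_val).subtype_mk _⟩ := rfl
  rw [hfac, singularCohomology.map_comp, hZ.eq_of_tgt (singularCohomology.map ℤ ℤ (subsetIncl T) k) 0,
    zero_comp]

variable {M : Type} [TopologicalSpace M] [ChartedSpace (EuclideanSpace ℝ (Fin (m + 1))) M]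

/-- **The punctured model is the interior**: `int W ≃ₜ Ŵ ∖ ∞`, `z ↦ ofInterior z`. [folklore] -/
def puncturedHomeo (c : NullCobordism (m + 1) M) :
    ManifoldInterior (m + 1) c.W ≃ₜ ↥({ClosedModel.infty}ᶜ : Set (ClosedModel (m + 1) c.W)) :=
  (OnePoint.isOpenEmbedding_coe.isEmbedding.toHomeomorph).trans
    (Homeomorph.setCongr OnePoint.compl_infty.symm)

/-- Values of `puncturedHomeo`. [folklore] -/
@[simp] theorem puncturedHomeo_apply_coe (c : NullCobordism (m + 1) M) (z : ManifoldInterior (m + 1) c.W) :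
    (c.puncturedHomeo z : ClosedModel (m + 1) c.W) = ClosedModel.ofInterior z := rfl

omit [IsManifold (𝓡 (m + 1)) ∞ MP] [CompactSpace MP] [IsManifold (𝓡 (m + 1)) ∞ MU] [CompactSpace MU] in
/-- `ofInterior z ∈ transferSet e ↔ z ∈ range e`. [folklore] -/
theorem ofInterior_mem_transferSet_iff {cP : NullCobordism (m + 1) MP} {cU : NullCobordism (m + 1) MU}
    (e : C(ManifoldInterior (m + 1) cP.W, ManifoldInterior (m + 1) cU.W))
    (z : ManifoldInterior (m + 1) cU.W) :
    ClosedModel.ofInterior z ∈ transferSet e ↔ z ∈ range e := by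
  constructor
  · rintro ⟨y, hy⟩
    exact ⟨y, OnePoint.coe_injective hy⟩
  · rintro ⟨y, rfl⟩
    exact ⟨y, rfl⟩

omit [IsManifold (𝓡 (m + 1)) ∞ MP] [CompactSpace MP] [IsManifold (𝓡 (m + 1)) ∞ MU] [CompactSpace MU] in
/-- `∞ ∉ transferSet e`. [folklore] -/
theorem infty_not_mem_transferSet {cP : NullCobordism (m + 1) MP} {cU : NullCobordism (m + 1) MU}
    (e : C(ManifoldInterior (m + 1) cP.W, ManifoldInterior (m + 1) cU.W)) :
    (ClosedModel.infty : ClosedModel (m + 1) cU.W) ∉ transferSet e := by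
  rintro ⟨y, hy⟩
  exact OnePoint.coe_ne_infty _ hy

omit [IsManifold (𝓡 (m + 1)) ∞ MP] [CompactSpace MP] [IsManifold (𝓡 (m + 1)) ∞ MU] [CompactSpace MU] in
/-- A point of the embedded copy is `ofInterior (e y)` with `y` its `transferHomeo`-image.
[folklore] -/
theorem coe_eq_ofInterior_transferHomeo {cP : NullCobordism (m + 1) MP} {cU : NullCobordism (m + 1) MU}
    (e : C(ManifoldInterior (m + 1) cP.W, ManifoldInterior (m + 1) cU.W)) (he : IsOpenEmbedding e)
    (a : ↥(transferSet e)) :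
    (a : ClosedModel (m + 1) cU.W) = ClosedModel.ofInterior (e (transferHomeo e he a)) := by
  obtain ⟨y, hy⟩ := a.2
  have ha : a = ⟨ClosedModel.ofInterior (e y), ⟨y, rfl⟩⟩ := Subtype.ext hy.symm
  subst ha
  rw [transferHomeo_apply_mk]

/-- Transport of a `toLocal` identity along an equality of base points. [folklore] -/
theorem _root_.Literature.AlgebraicTopology.SingularHomology.singularHomology.toLocal_eq_map_iff_of_eq
    {X Y : Type} [TopologicalSpace X] [TopologicalSpace Y] {p q : X} (hpq : p = q) (k : ℕ)
    (a : singularHomology ℤ ℤ X k) (f : C(Y, X)) {y : Y}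
    (hp : MapsTo f ({y}ᶜ : Set Y) ({p}ᶜ : Set X)) (hq : MapsTo f ({y}ᶜ : Set Y) ({q}ᶜ : Set X))
    (ζ : localHomology ℤ ℤ Y y k) :
    (singularHomology.toLocal ℤ ℤ p k a = relativeSingularHomology.map ℤ ℤ f hp k ζ) ↔
      (singularHomology.toLocal ℤ ℤ q k a = relativeSingularHomology.map ℤ ℤ f hq k ζ) := by
  subst hpq
  exact Iff.rfl

/-! ### The additivity theorem -/

namespace BCSGluing

variable [Nonempty MS] [Nonempty MT] [Nonempty MU]
variable (G : BCSGluing cS cT cU) (hS : G.S.ContainsInterior) (hT : G.T.ContainsInterior)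

/-- The inclusion `int W_P → A_P` as a continuous map. [folklore] -/
abbrev ofIntCM {cP : NullCobordism (m + 1) MP} {P : Piece cP cU} (hP : P.ContainsInterior) :
    C(ManifoldInterior (m + 1) cP.W, P.A) :=
  ⟨fun y => Piece.ofInt hP y, continuous_subtype_val.subtype_mk _⟩

omit [IsManifold (𝓡 (m + 1)) ∞ MU] [CompactSpace MU] [Nonempty MU]
  [IsManifold (𝓡 (m + 1)) ∞ MP] [CompactSpace MP] in
/-- `int W_P → A_P` is an open embedding. [folklore] -/
theorem isOpenEmbedding_ofIntCM {cP : NullCobordism (m + 1) MP} {P : Piece cP cU}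
    (hP : P.ContainsInterior) : IsOpenEmbedding (ofIntCM hP) := by
  refine IsOpenEmbedding.of_comp _ P.isOpenEmbedding_ι ?_
  exact ((𝓡∂ (m + 1 + 1)).isOpen_interior (M := cP.W) one_ne_zero).isOpenEmbedding_subtypeVal

set_option maxHeartbeats 1000000 in
omit [CompactSpace MU] [Nonempty MU] [IsManifold (𝓡 (m + 1)) ∞ MP] [CompactSpace MP]
  [IsManifold (𝓡 (m + 1)) ∞ MU] in
/-- `q_U ∘ j ∘ (int W_P ↪ A_P) = ofInterior ∘ e` as continuous maps (the final `exact` is a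
slow definitional unfolding, hence the heartbeat bump). [folklore] -/
theorem boundaryCollapse_comp_j_comp_ofIntCM {cP : NullCobordism (m + 1) MP} {P : Piece cP cU}
    (hP : P.ContainsInterior) :
    ((boundaryCollapse (m + 1) cU.W).comp P.j).comp (ofIntCM hP) =
      (ofInteriorCM cU).comp (Piece.interiorEmb hP) := by
  refine ContinuousMap.ext fun z => ?_
  rw [ContinuousMap.comp_apply, ContinuousMap.comp_apply, ContinuousMap.comp_apply,
    Piece.interiorEmb_apply]
  exact boundaryCollapse_of_mem_interior (P.j_mem_interior z.2)

omit [IsManifold (𝓡 (m + 1)) ∞ MU] [CompactSpace MU] [Nonempty MU] [CompactSpace MP]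
  [IsManifold (𝓡 (m + 1)) ∞ MP] in
/-- `q_P ∘ ι ∘ (int W_P ↪ A_P) = ofInterior` as continuous maps. [folklore] -/
theorem boundaryCollapse_comp_ι_comp_ofIntCM {cP : NullCobordism (m + 1) MP} {P : Piece cP cU}
    (hP : P.ContainsInterior) :
    ((boundaryCollapse (m + 1) cP.W).comp P.ι).comp (ofIntCM hP) = ofInteriorCM cP := by
  refine ContinuousMap.ext fun z => ?_
  have h1 : (((boundaryCollapse (m + 1) cP.W).comp P.ι).comp (ofIntCM hP)) z =
      boundaryCollapse (m + 1) cP.W z.1 := rfl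
  have h2 : (ofInteriorCM cP) z = ClosedModel.ofInterior ⟨z.1, z.2⟩ := rfl
  rw [h1, h2]
  exact boundaryCollapse_of_mem_interior z.2

omit [CompactSpace MP] [CompactSpace MU] [Nonempty MU] [IsManifold (𝓡 (m + 1)) ∞ MP]
  [IsManifold (𝓡 (m + 1)) ∞ MU] in
/-- **The local identities feeding the fundamental class transfer.** If the relative fundamental
class `w_U` restricts on `j(A_P ∖ ∂)` to the transported local classes of `w_P`
(`BCSGluing.exists_isRelFundamentalClass`), then at every interior point `y` the local classes of
`[Ŵ_U] = c_{w_U}` at `e y` and of `[Ŵ_P] = c_{w_P}` at `y` come from one class on `int W_P`.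
[cite: KervaireMilnorAnnals1963, §2 p. 508] -/
theorem hloc_of_rel {cP : NullCobordism (m + 1) MP} [Nonempty MP] [T2Space MP] (P : Piece cP cU)
    (hP : P.ContainsInterior)
    (wP : relativeSingularHomology ℤ ℤ cP.W ((𝓡∂ (m + 1 + 1)).boundary cP.W) (m + 1 + 1))
    (wU : relativeSingularHomology ℤ ℤ cU.W ((𝓡∂ (m + 1 + 1)).boundary cU.W) (m + 1 + 1))
    (hrel : ∀ (x : P.A) (hx : (x : cP.W) ∈ ((𝓡∂ (m + 1 + 1)).boundary cP.W)ᶜ),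
      relativeSingularHomology.toLocal ℤ ℤ _ ⟨P.j x, P.j_mem_compl_boundary hx⟩ (m + 1 + 1) wU =
        relativeSingularHomology.map ℤ ℤ P.j (LocalFamily.mapsTo_compl_pt P.j_injective x) (m + 1 + 1)
          (P.pieceClass wP x))
    (y : ManifoldInterior (m + 1) cP.W) :
    ∃ ζ : localHomology ℤ ℤ (ManifoldInterior (m + 1) cP.W) y (m + 1 + 1),
      singularHomology.toLocal ℤ ℤ (ClosedModel.ofInterior (Piece.interiorEmb hP y)) (m + 1 + 1)
          (cU.closedModelClass ℤ ℤ (Nat.succ_pos m) wU) =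
        relativeSingularHomology.map ℤ ℤ ((ofInteriorCM cU).comp (Piece.interiorEmb hP))
          (LocalFamily.mapsTo_compl_pt (isOpenEmbedding_ofInterior_comp (Piece.interiorEmb hP)
            (Piece.isOpenEmbedding_interiorEmb hP)).injective y) (m + 1 + 1) ζ ∧
      singularHomology.toLocal ℤ ℤ (ClosedModel.ofInterior y) (m + 1 + 1)
          (cP.closedModelClass ℤ ℤ (Nat.succ_pos m) wP) =
        relativeSingularHomology.map ℤ ℤ (ofInteriorCM cP)
          (LocalFamily.mapsTo_compl_pt (isOpenEmbedding_ofInteriorCM cP).injective y) (m + 1 + 1) ζ := by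
  have hn : 1 ≤ m + 1 := Nat.succ_pos m
  -- the class on `int W_P`: the piece class pulled back along the open embedding `int W_P → A_P`
  haveI hiso := localHomology.isIso_map_of_isOpenEmbedding_of_eq ℤ ℤ (ofIntCM hP) (isOpenEmbedding_ofIntCM hP) y
    rfl (m + 1 + 1)
  set ζ := inv (relativeSingularHomology.map ℤ ℤ (ofIntCM hP)
    (LocalFamily.mapsTo_compl_pt (isOpenEmbedding_ofIntCM hP).injective y) (m + 1 + 1))
    (P.pieceClass wP (Piece.ofInt hP y)) with hζ
  have hζ' : relativeSingularHomology.map ℤ ℤ (ofIntCM hP)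
      (LocalFamily.mapsTo_compl_pt (isOpenEmbedding_ofIntCM hP).injective y) (m + 1 + 1) ζ =
      P.pieceClass wP (Piece.ofInt hP y) := by
    rw [hζ, ← ModuleCat.comp_apply, IsIso.inv_hom_id, ModuleCat.id_apply]
  have hyint : (y.1 : cP.W) ∈ (𝓡∂ (m + 1 + 1)).interior cP.W := y.2
  have hycb : (y.1 : cP.W) ∈ ((𝓡∂ (m + 1 + 1)).boundary cP.W)ᶜ := by
    rw [ModelWithCorners.compl_boundary]; exact y.2
  have hjint : (P.j (Piece.ofInt hP y) : cU.W) ∈ (𝓡∂ (m + 1 + 1)).interior cU.W := P.j_mem_interior y.2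
  refine ⟨ζ, ?_, ?_⟩
  · -- at `e y`: `[Ŵ_U]|` = `q_U_*(w_U|_{j y})` = `q_U_* j_* (pieceClass)` = `(q_U ∘ j ∘ ofInt)_* ζ`
    have e1 : boundaryCollapse (m + 1) cU.W (P.j (Piece.ofInt hP y)) =
        ClosedModel.ofInterior (Piece.interiorEmb hP y) := boundaryCollapse_of_mem_interior hjint
    let f : C(ManifoldInterior (m + 1) cP.W, ClosedModel (m + 1) cU.W) :=
      ((boundaryCollapse (m + 1) cU.W).comp P.j).comp (ofIntCM hP)
    have hfp : MapsTo f ({y}ᶜ : Set _) ({boundaryCollapse (m + 1) cU.W (P.j (Piece.ofInt hP y))}ᶜ : Set _) :=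
      ((cU.mapsTo_boundaryCollapse_compl_singleton hjint).comp
        (LocalFamily.mapsTo_compl_pt P.j_injective (Piece.ofInt hP y))).comp
          (LocalFamily.mapsTo_compl_pt (isOpenEmbedding_ofIntCM hP).injective y)
    have hfq : MapsTo f ({y}ᶜ : Set _) ({ClosedModel.ofInterior (Piece.interiorEmb hP y)}ᶜ : Set _) := by
      rw [← e1]; exact hfp
    have s1 := cU.toLocal_closedModelClass_of_mem_interior ℤ ℤ hn wU hjint
    have s2 := hrel (Piece.ofInt hP y) hycb
    have s3 : singularHomology.toLocal ℤ ℤ (boundaryCollapse (m + 1) cU.W (P.j (Piece.ofInt hP y)))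
        (m + 1 + 1) (cU.closedModelClass ℤ ℤ hn wU) = relativeSingularHomology.map ℤ ℤ f hfp (m + 1 + 1) ζ := by
      rw [s1, s2, ← hζ', ← ModuleCat.comp_apply, ← ModuleCat.comp_apply,
        ← relativeSingularHomology.map_comp, ← relativeSingularHomology.map_comp]
    have s4 := (singularHomology.toLocal_eq_map_iff_of_eq e1 (m + 1 + 1) _ f hfp hfq ζ).1 s3
    have hfg : f = (ofInteriorCM cU).comp (Piece.interiorEmb hP) := boundaryCollapse_comp_j_comp_ofIntCM hP
    exact s4.trans (ConcreteCategory.congr_hom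
      (relativeSingularHomology.map_congr_fun' (R := ℤ) hfg hfq _ (m + 1 + 1)) ζ)
  · -- at `y`: `[Ŵ_P]|` = `q_P_*(w_P|_y)` = `q_P_* ι_* (pieceClass)` = `(q_P ∘ ι ∘ ofInt)_* ζ`
    have e2 : boundaryCollapse (m + 1) cP.W y.1 = ClosedModel.ofInterior y := by
      rw [boundaryCollapse_of_mem_interior hyint]; rfl
    let f : C(ManifoldInterior (m + 1) cP.W, ClosedModel (m + 1) cP.W) :=
      ((boundaryCollapse (m + 1) cP.W).comp P.ι).comp (ofIntCM hP)
    have hfp : MapsTo f ({y}ᶜ : Set _) ({boundaryCollapse (m + 1) cP.W y.1}ᶜ : Set _) :=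
      ((cP.mapsTo_boundaryCollapse_compl_singleton hyint).comp
        (LocalFamily.mapsTo_compl_pt P.ι_injective (Piece.ofInt hP y))).comp
          (LocalFamily.mapsTo_compl_pt (isOpenEmbedding_ofIntCM hP).injective y)
    have hfq : MapsTo f ({y}ᶜ : Set _) ({ClosedModel.ofInterior y}ᶜ : Set _) := by
      rw [← e2]; exact hfp
    have s1 := cP.toLocal_closedModelClass_of_mem_interior ℤ ℤ hn wP hyint
    have s2 := (P.map_ι_pieceClass_of_mem wP (Piece.ofInt hP y) hycb).symm
    have s3 : singularHomology.toLocal ℤ ℤ (boundaryCollapse (m + 1) cP.W y.1)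
        (m + 1 + 1) (cP.closedModelClass ℤ ℤ hn wP) = relativeSingularHomology.map ℤ ℤ f hfp (m + 1 + 1) ζ := by
      rw [s1]
      erw [s2]
      rw [← hζ', ← ModuleCat.comp_apply, ← ModuleCat.comp_apply,
        ← relativeSingularHomology.map_comp, ← relativeSingularHomology.map_comp]
    have s4 := (singularHomology.toLocal_eq_map_iff_of_eq e2 (m + 1 + 1) _ f hfp hfq ζ).1 s3
    have hfg : f = ofInteriorCM cP := boundaryCollapse_comp_ι_comp_ofIntCM hP
    exact s4.trans (ConcreteCategory.congr_hom
      (relativeSingularHomology.map_congr_fun' (R := ℤ) hfg hfq _ (m + 1 + 1)) ζ)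

/-- **Additivity of the signature over a glued null-cobordism** (Kervaire–Milnor 1963, §2 p. 508:
`σ(W₁ ♮ W₂) = σ(W₁) + σ(W₂)`). Data: the gluing `G` of `W_U` from pieces of `W_S`, `W_T`
containing the interiors; collars `κ_S`, `κ_T`, `κ_U`; the glued points of each piece lie in its
collar neighbourhood; the interior overlap is contractible; `H^j(M_P; ℤ) = 0` for
`1 ≤ j ≤ k` (`M_P` homology spheres, `2 ≤ k`); relative fundamental classes `w_S`, `w_T`, `w_U`
with `w_U` restricting on the pieces to the transported local classes of `w_S`, `w_T`; and
`ℤ`-orientations of the three closed models whose fundamental classes are the closed-model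
classes `c_{w}`. Then, in formal dimension `k + k = m + 2` with `k` even,
`σ(Ŵ_U) = σ(Ŵ_S) + σ(Ŵ_T)`. [cite: KervaireMilnorAnnals1963, §2 p. 508] -/
theorem signatureInDim_eq_add [T2Space MS] [T2Space MT]
    (κS : cS.boundaryData.Collar) (κT : cT.boundaryData.Collar) (κU : cU.boundaryData.Collar)
    (hST : ∀ x : G.S.A, G.S.j x ∈ range G.T.j → (x : cS.W) ∈ cS.collarNhd κS 1)
    (hTS : ∀ y : G.T.A, G.T.j y ∈ range G.S.j → (y : cT.W) ∈ cT.collarNhd κT 1)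
    (hO : ContractibleSpace ↥(range (Piece.interiorEmb hS) ∩ range (Piece.interiorEmb hT)))
    {k : ℕ} (h : k + k = m + 1 + 1) (hk : Even k) (hk2 : 2 ≤ k)
    (hMS : ∀ j, 1 ≤ j → j ≤ k → IsZero (singularCohomology ℤ ℤ MS j))
    (hMT : ∀ j, 1 ≤ j → j ≤ k → IsZero (singularCohomology ℤ ℤ MT j))
    (hMU : ∀ j, 1 ≤ j → j ≤ k → IsZero (singularCohomology ℤ ℤ MU j))
    (wS : relativeSingularHomology ℤ ℤ cS.W ((𝓡∂ (m + 1 + 1)).boundary cS.W) (m + 1 + 1))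
    (wT : relativeSingularHomology ℤ ℤ cT.W ((𝓡∂ (m + 1 + 1)).boundary cT.W) (m + 1 + 1))
    (wU : relativeSingularHomology ℤ ℤ cU.W ((𝓡∂ (m + 1 + 1)).boundary cU.W) (m + 1 + 1))
    (relS : ∀ (x : G.S.A) (hx : (x : cS.W) ∈ ((𝓡∂ (m + 1 + 1)).boundary cS.W)ᶜ),
      relativeSingularHomology.toLocal ℤ ℤ _ ⟨G.S.j x, G.S.j_mem_compl_boundary hx⟩ (m + 1 + 1) wU =
        relativeSingularHomology.map ℤ ℤ G.S.j (LocalFamily.mapsTo_compl_pt G.S.j_injective x)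
          (m + 1 + 1) (G.S.pieceClass wS x))
    (relT : ∀ (x : G.T.A) (hx : (x : cT.W) ∈ ((𝓡∂ (m + 1 + 1)).boundary cT.W)ᶜ),
      relativeSingularHomology.toLocal ℤ ℤ _ ⟨G.T.j x, G.T.j_mem_compl_boundary hx⟩ (m + 1 + 1) wU =
        relativeSingularHomology.map ℤ ℤ G.T.j (LocalFamily.mapsTo_compl_pt G.T.j_injective x)
          (m + 1 + 1) (G.T.pieceClass wT x))
    (μU : HomologicalOrientation ℤ (ClosedModel (m + 1) cU.W) (m + 1 + 1))
    (μS : HomologicalOrientation ℤ (ClosedModel (m + 1) cS.W) (m + 1 + 1))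
    (μT : HomologicalOrientation ℤ (ClosedModel (m + 1) cT.W) (m + 1 + 1))
    (hμU : μU.fundamentalClass = cU.closedModelClass ℤ ℤ (Nat.succ_pos m) wU)
    (hμS : μS.fundamentalClass = cS.closedModelClass ℤ ℤ (Nat.succ_pos m) wS)
    (hμT : μT.fundamentalClass = cT.closedModelClass ℤ ℤ (Nat.succ_pos m) wT)
    [Module.Finite ℤ (freeCohomology ℤ (ClosedModel (m + 1) cU.W) k)]
    [Module.Finite ℤ (freeCohomology ℤ (ClosedModel (m + 1) cS.W) k)]
    [Module.Finite ℤ (freeCohomology ℤ (ClosedModel (m + 1) cT.W) k)] :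
    μU.signatureInDim h = μS.signatureInDim h + μT.signatureInDim h := by
  -- the interior embeddings and the collapses
  set eS := Piece.interiorEmb hS with heS_def
  set eT := Piece.interiorEmb hT with heT_def
  have heS : IsOpenEmbedding eS := Piece.isOpenEmbedding_interiorEmb hS
  have heT : IsOpenEmbedding eT := Piece.isOpenEmbedding_interiorEmb hT
  set πS := closedModelTransfer eS heS with hπS
  set πT := closedModelTransfer eT heT with hπT
  have hkn : (m + 1 + 1) ≠ 0 := by omega
  have hk0 : k ≠ 0 := by omega
  -- (1) fundamental classes
  have hfcS : singularHomology.map ℤ ℤ πS (m + 1 + 1) μU.fundamentalClass = μS.fundamentalClass := by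
    rw [hμU, hμS]
    exact map_closedModelTransfer_closedModelClass eS heS wS wU (hloc_of_rel G.S hS wS wU relS)
  have hfcT : singularHomology.map ℤ ℤ πT (m + 1 + 1) μU.fundamentalClass = μT.fundamentalClass := by
    rw [hμU, hμT]
    exact map_closedModelTransfer_closedModelClass eT heT wT wU (hloc_of_rel G.T hT wT wU relT)
  -- where the collapses send the pieces
  have hπS_of_not : ∀ z : ManifoldInterior (m + 1) cU.W, z ∉ range eS →
      πS (ClosedModel.ofInterior z) = ClosedModel.infty := fun z hz =>
    closedModelTransfer_apply_of_not_mem eS heS (mt (ofInterior_mem_transferSet_iff eS z).1 hz)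
  have hπT_of_not : ∀ z : ManifoldInterior (m + 1) cU.W, z ∉ range eT →
      πT (ClosedModel.ofInterior z) = ClosedModel.infty := fun z hz =>
    closedModelTransfer_apply_of_not_mem eT heT (mt (ofInterior_mem_transferSet_iff eT z).1 hz)
  have hπS_infty : πS ClosedModel.infty = ClosedModel.infty :=
    closedModelTransfer_apply_of_not_mem eS heS (infty_not_mem_transferSet eS)
  have hπT_infty : πT ClosedModel.infty = ClosedModel.infty :=
    closedModelTransfer_apply_of_not_mem eT heT (infty_not_mem_transferSet eT)
  -- an overlap point read in `W_S` lies in the collar, hence maps into the cone neighbourhood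
  have hπS_overlap : ∀ (y : ManifoldInterior (m + 1) cS.W), eS y ∈ range eT →
      πS (ClosedModel.ofInterior (eS y)) ∈ cS.coneNhd κS 1 := by
    intro y hy
    rw [closedModelTransfer_ofInterior_apply]
    refine (cS.ofInterior_mem_coneNhd_iff κS y).2 (hST (Piece.ofInt hS y) ?_)
    obtain ⟨y', hy'⟩ := hy
    exact ⟨Piece.ofInt hT y', congrArg (fun z : ManifoldInterior (m + 1) cU.W => z.1) hy'⟩
  have hπT_overlap : ∀ (y : ManifoldInterior (m + 1) cT.W), eT y ∈ range eS →
      πT (ClosedModel.ofInterior (eT y)) ∈ cT.coneNhd κT 1 := by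
    intro y hy
    rw [closedModelTransfer_ofInterior_apply]
    refine (cT.ofInterior_mem_coneNhd_iff κT y).2 (hTS (Piece.ofInt hT y) ?_)
    obtain ⟨y', hy'⟩ := hy
    exact ⟨Piece.ofInt hS y', congrArg (fun z : ManifoldInterior (m + 1) cU.W => z.1) hy'⟩
  -- (2) the cover killing cross terms
  set U : Set (ClosedModel (m + 1) cU.W) := πS ⁻¹' cS.coneNhd κS 1 with hU_def
  set V : Set (ClosedModel (m + 1) cU.W) := πT ⁻¹' cT.coneNhd κT 1 with hV_def
  have hUo : IsOpen U := (cS.isOpen_coneNhd κS one_pos le_rfl).preimage πS.continuous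
  have hVo : IsOpen V := (cT.isOpen_coneNhd κT one_pos le_rfl).preimage πT.continuous
  have hUV : U ∪ V = univ := by
    refine eq_univ_of_forall fun x => ?_
    induction x using OnePoint.rec with
    | infty => exact Or.inl (show πS ClosedModel.infty ∈ _ by rw [hπS_infty]; exact cS.infty_mem_coneNhd κS 1)
    | coe z =>
      by_cases hzS : z ∈ range eS
      · obtain ⟨y, rfl⟩ := hzS
        by_cases hzT : eS y ∈ range eT
        · exact Or.inl (hπS_overlap y hzT)
        · refine Or.inr ?_
          change πT (ClosedModel.ofInterior (eS y)) ∈ cT.coneNhd κT 1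
          rw [hπT_of_not _ hzT]
          exact cT.infty_mem_coneNhd κT 1
      · refine Or.inl ?_
        change πS (ClosedModel.ofInterior z) ∈ cS.coneNhd κS 1
        rw [hπS_of_not _ hzS]
        exact cS.infty_mem_coneNhd κS 1
  have hSU : singularCohomology.map ℤ ℤ (πS.comp (subsetIncl U)) k = 0 :=
    singularCohomology.map_comp_subsetIncl_eq_zero_of_mapsTo πS (mapsTo_preimage πS _)
      (cS.isZero_singularCohomology_coneNhd κS hk0)
  have hTV : singularCohomology.map ℤ ℤ (πT.comp (subsetIncl V)) k = 0 :=
    singularCohomology.map_comp_subsetIncl_eq_zero_of_mapsTo πT (mapsTo_preimage πT _)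
      (cT.isZero_singularCohomology_coneNhd κT hk0)
  -- (3) the two open copies of the interiors
  set A : Set (ClosedModel (m + 1) cU.W) := transferSet eS with hA_def
  set B : Set (ClosedModel (m + 1) cU.W) := transferSet eT with hB_def
  -- (3a) `π_T` sends `A` into the cone neighbourhood of `∞_T`, `π_S` sends `B` into that of `∞_S`
  have hTA' : MapsTo πT A (cT.coneNhd κT 1) := by
    rintro x ⟨y, rfl⟩
    change πT (ClosedModel.ofInterior (eS y)) ∈ cT.coneNhd κT 1
    by_cases hzT : eS y ∈ range eT
    · obtain ⟨y', hy'⟩ := hzT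
      rw [← hy']
      exact hπT_overlap y' ⟨y, hy'.symm⟩
    · rw [hπT_of_not _ hzT]
      exact cT.infty_mem_coneNhd κT 1
  have hSB' : MapsTo πS B (cS.coneNhd κS 1) := by
    rintro x ⟨y, rfl⟩
    change πS (ClosedModel.ofInterior (eT y)) ∈ cS.coneNhd κS 1
    by_cases hzS : eT y ∈ range eS
    · obtain ⟨y', hy'⟩ := hzS
      rw [← hy']
      exact hπS_overlap y' ⟨y, hy'.symm⟩
    · rw [hπS_of_not _ hzS]
      exact cS.infty_mem_coneNhd κS 1
  have hTA : singularCohomology.map ℤ ℤ (πT.comp (subsetIncl A)) k = 0 :=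
    singularCohomology.map_comp_subsetIncl_eq_zero_of_mapsTo πT hTA'
      (cT.isZero_singularCohomology_coneNhd κT hk0)
  have hSB : singularCohomology.map ℤ ℤ (πS.comp (subsetIncl B)) k = 0 :=
    singularCohomology.map_comp_subsetIncl_eq_zero_of_mapsTo πS hSB'
      (cS.isZero_singularCohomology_coneNhd κS hk0)
  -- (3b) `(π_S|_A)^*` and `(π_T|_B)^*` are bijective: `π_S|_A` is the homeomorphism `A ≅ Ŵ_S ∖ ∞`
  have hSA : Bijective (singularCohomology.map ℤ ℤ (πS.comp (subsetIncl A)) k) := by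
    let ψ : ↥A ≃ₜ ↥({ClosedModel.infty}ᶜ : Set (ClosedModel (m + 1) cS.W)) :=
      (transferHomeo eS heS).trans cS.puncturedHomeo
    have hfac : πS.comp (subsetIncl A) =
        (subsetIncl ({ClosedModel.infty}ᶜ : Set (ClosedModel (m + 1) cS.W))).comp (ψ : C(↥A, _)) := by
      ext a
      change πS (a : ClosedModel (m + 1) cU.W) = ClosedModel.ofInterior (transferHomeo eS heS a)
      rw [coe_eq_ofInterior_transferHomeo eS heS a, closedModelTransfer_ofInterior_apply]
    rw [hfac, singularCohomology.map_comp]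
    exact ((forget (ModuleCat ℤ)).mapIso (singularCohomology.mapIso ℤ ℤ ψ k)).toEquiv.bijective.comp
      (cS.bijective_map_subsetIncl_compl_infty κS hk2 hMS)
  have hTB : Bijective (singularCohomology.map ℤ ℤ (πT.comp (subsetIncl B)) k) := by
    let ψ : ↥B ≃ₜ ↥({ClosedModel.infty}ᶜ : Set (ClosedModel (m + 1) cT.W)) :=
      (transferHomeo eT heT).trans cT.puncturedHomeo
    have hfac : πT.comp (subsetIncl B) =
        (subsetIncl ({ClosedModel.infty}ᶜ : Set (ClosedModel (m + 1) cT.W))).comp (ψ : C(↥B, _)) := by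
      ext a
      change πT (a : ClosedModel (m + 1) cU.W) = ClosedModel.ofInterior (transferHomeo eT heT a)
      rw [coe_eq_ofInterior_transferHomeo eT heT a, closedModelTransfer_ofInterior_apply]
    rw [hfac, singularCohomology.map_comp]
    exact ((forget (ModuleCat ℤ)).mapIso (singularCohomology.mapIso ℤ ℤ ψ k)).toEquiv.bijective.comp
      (cT.bijective_map_subsetIncl_compl_infty κT hk2 hMT)
  -- (3c) joint injectivity of the two restrictions: Mayer–Vietoris on `Ŵ_U ∖ ∞`, then `Hᵏ(Ŵ_U) ↪ Hᵏ(Ŵ_U ∖ ∞)`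
  have hinj : ∀ c : singularCohomology ℤ ℤ (ClosedModel (m + 1) cU.W) k,
      singularCohomology.map ℤ ℤ (subsetIncl A) k c = 0 →
        singularCohomology.map ℤ ℤ (subsetIncl B) k c = 0 → c = 0 := by
    intro c ha hb
    obtain ⟨p, rfl⟩ : ∃ p, k = p + 1 := ⟨k - 1, by omega⟩
    set P : Set (ClosedModel (m + 1) cU.W) := {ClosedModel.infty}ᶜ with hP_def
    apply (cU.bijective_map_subsetIncl_compl_infty κU hk2 hMU).1
    rw [map_zero]
    -- Mayer–Vietoris on `↥P` with the cover by the preimages of `A`, `B`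
    have hA' : IsOpen (Subtype.val ⁻¹' A : Set ↥P) := (isOpen_transferSet eS heS).preimage continuous_subtype_val
    have hB' : IsOpen (Subtype.val ⁻¹' B : Set ↥P) := (isOpen_transferSet eT heT).preimage continuous_subtype_val
    have hcov : (Subtype.val ⁻¹' A : Set ↥P) ∪ Subtype.val ⁻¹' B = univ := by
      refine eq_univ_of_forall fun w => ?_
      obtain ⟨z, hz⟩ := OnePoint.ne_infty_iff_exists.1 w.2
      have hzc : z ∈ range eS ∪ range eT := by rw [G.range_interiorEmb_union hS hT]; exact mem_univ _
      rcases hzc with hzS | hzT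
      · exact Or.inl (show w.1 ∈ A by rw [← hz]; exact (ofInterior_mem_transferSet_iff eS z).2 hzS)
      · exact Or.inr (show w.1 ∈ B by rw [← hz]; exact (ofInterior_mem_transferSet_iff eT z).2 hzT)
    -- the overlap `↥(val⁻¹ A ∩ val⁻¹ B) ≅ ↥(range e_S ∩ range e_T)` is contractible
    have hZ : IsZero (singularCohomology ℤ ℤ
        ↥((Subtype.val ⁻¹' A : Set ↥P) ∩ Subtype.val ⁻¹' B) p) := by
      let θ : ↥(range eS ∩ range eT) ≃ₜ ↥((Subtype.val ⁻¹' A : Set ↥P) ∩ Subtype.val ⁻¹' B) :=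
        cU.puncturedHomeo.subtype (p := fun z => z ∈ range eS ∩ range eT)
          (q := fun w => w ∈ (Subtype.val ⁻¹' A : Set ↥P) ∩ Subtype.val ⁻¹' B) fun z => by
            change z ∈ range eS ∩ range eT ↔
              ClosedModel.ofInterior z ∈ A ∧ ClosedModel.ofInterior z ∈ B
            rw [ofInterior_mem_transferSet_iff, ofInterior_mem_transferSet_iff]
            rfl
      haveI : ContractibleSpace ↥((Subtype.val ⁻¹' A : Set ↥P) ∩ Subtype.val ⁻¹' B) :=
        θ.contractibleSpace_iff.1 hO
      exact IsZero.of_iso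
        (singularCochainComplex.isZero_singularCohomology_of_subsingleton' (R := ℤ) (M := ℤ) (by omega))
        (singularCohomology.isoOfContractible ℤ ℤ _ p).symm
    refine singularCohomology.eq_zero_of_map_subsetIncl_eq_zero ℤ hA' hB' hcov hZ _ ?_ ?_
    · have hfac : (subsetIncl P).comp (subsetIncl (Subtype.val ⁻¹' A : Set ↥P)) =
          (subsetIncl A).comp ⟨fun w => ⟨w.1.1, w.2⟩, (continuous_subtype_val.comp
            continuous_subtype_val).subtype_mk _⟩ := rfl
      rw [← ModuleCat.comp_apply, ← singularCohomology.map_comp, hfac, singularCohomology.map_comp,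
        ModuleCat.comp_apply, ha, map_zero]
    · have hfac : (subsetIncl P).comp (subsetIncl (Subtype.val ⁻¹' B : Set ↥P)) =
          (subsetIncl B).comp ⟨fun w => ⟨w.1.1, w.2⟩, (continuous_subtype_val.comp
            continuous_subtype_val).subtype_mk _⟩ := rfl
      rw [← ModuleCat.comp_apply, ← singularCohomology.map_comp, hfac, singularCohomology.map_comp,
        ModuleCat.comp_apply, hb, map_zero]
  -- (4) the cohomological mechanism
  exact HomologicalOrientation.signatureInDim_eq_add_of_collapse h hk μU μS μT πS πT hfcS hfcT hUo hVo
    hUV hSU hTV hinj hSA hTB hTA hSB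

end BCSGluing

end NullCobordism

end Literature.Topology.FourManifolds
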